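import Summits.ValiantsHypothesis.ValiantsHypothesis.Theses.GeneratorObstructions
import Summits.ValiantsHypothesis.ValiantsHypothesis.Theorems.GeneratorObstructionsGenInheritance

/-!
# Route GeneratorObstructions — typed split of the deciding crux `GenFlipThesis`

BC2-redirect of the RESTATED deciding crux `GenFlipThesis` (item stmt-ValiantsHypothesis-11653, at
least as strong as the summit through the route's proved supports) into its two OPEN pieces

* `PerGenDegreeSuperQP` (K1, stmt-ValiantsHypothesis-11654): the algebra of highest-weight vectors of
  `ℂ[Δ_m[per_m]]` (per_m in its own `m²` variables) has minimal generators beyond every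
  quasi-polynomial degree — a LOWER bound on the permanent side only;
* `PowGenDegreeQP` (K2, stmt-ValiantsHypothesis-11655): inside the quasi-polynomial window
  `m ≤ n = m + e ≤ 2^((log₂ m + c)^c)` every generator type of the algebra of highest-weight vectors
  of `ℂ[Δ_m[tr X^m]]` (`X` of size `n`) has quasi-polynomial degree — an UPPER bound on the
  trace-power side only;

glued by DEGREE OVERFLOW through the landed inheritance theorem `genInheritance_proof`
(stmt-ValiantsHypothesis-11659; `GeneratorObstructionsGenInheritance*.lean`, three files, 808
lines: generator types of `per_m` survive the block placement into `(m+e)²` variables with the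
same size): at an inherited generator type `χ'` of `per_m` of degree above K2's bound the
trace-power side has NO generator (`γ_χ'(tr X^m) = 0 < γ_χ'(per_m)`), at every size of the window.
Neither piece mentions the other side, neither implies `GenFlipThesis` or `ValiantsHypothesis`
(cheap probes `exact? | simpa | aesop` fail 4/4, planner folder `bc/`), and the seam is the
lower-bound / upper-bound seam of every representation-theoretic flip, not a conjunction split.
This is the arrow form `K1 → K2 → GenFlipThesis` used as `--glue-by` of the route split (the
support item `CruxesToThesis` = `K1 → K2 → GenInheritance → GenFlipThesis`, proved as
`cruxesToThesis_proof`, keeps the inheritance hypothesis explicit; here it is discharged).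
-/

-- `Summit.ValiantsHypothesis.ValiantsHypothesis.…` is the tree's mandated single-conjunct layout
-- (Sub = Summit), so the duplicated namespace component is intended.
set_option linter.dupNamespace false

namespace Summit.ValiantsHypothesis.ValiantsHypothesis.Theorems.GeneratorObstructions

open Summit.ValiantsHypothesis.ValiantsHypothesis.Theses.GeneratorObstructions

/-- **Typed split of the deciding crux** (route GeneratorObstructions, parent item
stmt-ValiantsHypothesis-11653): `PerGenDegreeSuperQP → PowGenDegreeQP → GenFlipThesis`.

Proof (degree overflow): given `c, m₀`, K2 at `c` yields the trace-side exponent `c₀`; K1 at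
exponent `c₀` beyond `max m₀ 1` yields `m` and a generator type `χ` of `per_m` (own variables) with
`m · 2^((log₂ m + c₀)^c₀) < -|χ|`; for each `e` in the window the landed inheritance theorem
`genInheritance_proof` transports `χ` to a generator type `χ'` of the block-placed `per_m` with
`|χ'| = |χ|`, so `γ_χ'(per_m) ≥ 1`; were `γ_χ'(per_m) ≤ γ_χ'(tr X^m)`, the trace side would have a
generator of type `χ'`, and K2's bound `-|χ'| ≤ m · 2^((log₂ m + c₀)^c₀)` contradicts K1's. -/
theorem genFlipThesis_of_subs : PerGenDegreeSuperQP → PowGenDegreeQP → GenFlipThesis := by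
  intro hK1 hK2 c m₀
  -- trace side: the generation exponent `c₀` valid throughout the window of constant `c`
  obtain ⟨c₀, hc₀⟩ := hK2 c
  -- permanent side: a late generator type `χ` at exponent `c₀`, for some `m ≥ max m₀ 1`
  obtain ⟨m, hm, χ, hγ, hdeg⟩ := hK1 c₀ (max m₀ 1)
  have hm₀ : m₀ ≤ m := le_trans (le_max_left _ _) hm
  have h1m : 1 ≤ m := le_trans (le_max_right _ _) hm
  refine ⟨m, hm₀, h1m, fun e he => ?_⟩
  -- inheritance (landed theorem, item 11659): `χ` survives the block placement with the same size
  obtain ⟨χ', hsize, hγ'⟩ :=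
    Summit.ValiantsHypothesis.ValiantsHypothesis.Theorems.genInheritance_proof m e h1m χ hγ
  refine ⟨χ', lt_of_not_ge fun hle => ?_⟩
  -- overflow: a trace-side generator of type `χ'` would sit below K2's bound, but `|χ'| = |χ|`
  have hne := (Nat.lt_of_lt_of_le (Nat.pos_of_ne_zero hγ') hle).ne'
  have hb := hc₀ m e h1m he χ' hne
  rw [hsize] at hb
  exact absurd (lt_of_lt_of_le hdeg hb) (lt_irrefl _)

end Summit.ValiantsHypothesis.ValiantsHypothesis.Theorems.GeneratorObstructions
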